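import Literature.MathematicalPhysics.QuantumFieldTheory.Balaban1983to89.Beta.AxialComposition
import Literature.MathematicalPhysics.QuantumFieldTheory.Balaban1983to89.Beta.SymbolExpansion
import Literature.MathematicalPhysics.QuantumFieldTheory.Balaban1983to89.B5Prop11Fiber

/-!
# `Balaban1983to89.Beta.AxialSymbol` — THE SYMBOL OF THE an3 BLOCK WEIGHTS: the Fourier multiplier of the
`AxialBlockWeights` / `AxialComposition` weights on `ℤ⁴` (the integer-coordinate transcription of the averaging in the
printed `Q_k` of [Balaban1984PropagatorsI] (INDEX B5) (1.18), cf. `AxialComposition.axialAvg`)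
IS the printed `u_k(p)·v_μ(p)` of (1.31)/(1.61) in the tree's existing transcription `B5Prop11Fiber.uSym · vSym`, for EVERY
`p′` and alias; on the zone its modulus squared IS the tree's `B4Strip.Ur · uFactorr` (= the printed `|u(p′+l)|²|v_μ(p′+l)|²`
of (1.62)), so `SymbolExpansion.aSym` (an1) is an alias sum of squared multipliers of THE SAME weights whose position-space
legs `AxialBlockWeights` (an3) delivers (β sub-cell, row BETA-an3 gen 5, node BETA-an3-g5-SYMBOL; BETA-SPEC v1.9n §6.12
OWNERS (vi), RULINGS (R7), (R10); companion of `Beta.AxialComposition` / `Beta.AxialBlockWeights` / `Beta.SymbolExpansion`;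
`ℤ⁴` counterpart, for the an3 objects, of the cell's finite-torus modules `B5Block118` / `B5Prop11Fiber`)

HONEST FRAMING (cell rule, verbatim): discharging `BetaPertH` makes Bałaban's UV stability UNCONDITIONAL — a real
constructive-QFT result; it is NOT the continuum limit and NOT the Clay problem.  (Gloss, BETA-SPEC v1.8d/v1.9b
l. 17–18, GAPS G-ref2-14 (a) / G-ref2-20 (a), verbatim: «UNCONDITIONAL» in [Balaban1989LargeFieldII] (B16) p. 355's
interval-hypothesis sense ONLY (`FlowStepRuns.p355Unconditional_of_partialSums` keeps `hnodes`); the located leaves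
G-adv3-2 (left inequality of (0.1)/(2.50), d = 4), G-adv3-1 (U2 transfer of B14 Cor. 3's lower bound) and `SecondExpLeaf`
REMAIN.  Gloss 2, BETA-SPEC v1.9e, beta-ref C-beta-78, BINDING: «unconditional» = `Beta.Assembly.EventualForm`-unconditional END
statement, NOT «Theorem 2 as printed».)  THIS MODULE DISCHARGES NOTHING of the series.  It KERNEL-CHECKS elementary
trigonometric-sum identities relating the Fourier multiplier of the printed averaging weights on `ℤ⁴` to the printed `u_k`,
`v_μ` (as already transcribed in the tree) and to the tree's vendored `|u|²`-factors.  Value = kernel certificate (audit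
cell `pub-balaban`, β sub-cell, unit `b2b-balaban-beta-an3-g5`), NOT summit progress.

THE PRINTED TEXT ([Balaban1984PropagatorsI], renders `pages/1984-cmp95-propagators-rt-I/…-p007-x2.png` (p. 23) and
`…-p012-x2.png` (p. 28) read as images, journal page = PDF page + 16).  p. 23: «The momentum representation on an arbitrary
torus T′_η = {x ∈ ηℤ^d : −L′_μ ≤ x_μ < L′_μ, μ = 1, …, d} is introduced by the Fourier transform f̃(p) = Σ_{x∈T′_η}
η^d e^{−ip·x} f(x), p ∈ T̃′_η, f(x) = (2π)^{−d} Σ_{p∈T̃′_η} (Π_{μ=1}^{d} π/L′_μ) e^{ix·p} f̃(p), (1.29)»; «Δ(p) =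
Σ_{μ=1}^{d} |∂_μ(p)|², ∂_μ(p) = (e^{iηp_μ} − 1)/η, u_k(p) = Π_{μ=1}^{d} (e^{ip′_μ} − 1)/((e^{iηp_μ} − 1)/η) =
Π_{μ=1}^{d} ∂¹_μ(p′)/∂_μ(p), (1.31) where p′ belongs to a dual torus T̃₁^{(k)} = {p′ = (p′₁, …, p′_d): p′_μ =
(π/L_μ)L^kε n_μ, n_μ is an integer, −L_μ/L^kε ≤ n_μ < L_μ/L^kε, μ = 1, …, d}, p ∈ T̃_η is represented as a sum
p = p′ + l, p′ ∈ T̃₁^{(k)} and l = (l₁, …, l_d), l_μ = 2πm_μ, m_μ is an integer, −(L^k − 1)/2 ≤ m_μ ≤ (L^k − 1)/2 for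
L odd, −L^k/2 ≤ m_μ < L^k/2 for L even.»; «Because u_k(l) = 0 for l ≠ 0, u_k(0) = 1, …».  p. 28 (after (1.60)): «Let us
write this operator in momentum representation.  (Q_kA)~_μ(p′) = Σ_l u(p′+l)v_μ(p′+l)Ã_μ(p′+l), v_μ(p) = ∂¹_μ(p′)/∂_μ(p),
(1.61) and operator φ as (φω)~_μ(p′) = φ_μ(p′)ω̃_μ(p′), φ_μ(p′) = Σ_l |u(p′+l)|²|v_μ(p′+l)|²/Δ(p′+l), (1.62) where we have
omitted the subscript k.»  (v1.1 DOCFIX, XREAD `ref6-g14` REFEREE6.md E78 V1 / GAPS G-ref6-6: v1 had put a non-printed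
clause «This operator is a simple multiplication operator in momentum representation and» inside the guillemets before
(1.62); the wording above is the print, render p012 re-read as image; advisory A1: title clause softened.  Kernel content
unchanged — every `def`/`theorem` below is byte-identical to v1 p181570.)
[Balaban1983RegularityDecay] (INDEX B4) p. 584 (2.45) prints the scalar-field analogue `u_j(p) = Π_{μ=1}^{d}
(e^{−ip_μ} − 1)/((e^{−iξp_μ} − 1)/ξ)`, `ξ = L^{−j}` (opposite sign convention, the same modulus), whose squared modulus on
the zone is the tree's `B4Strip.uFactorr` / `B4Strip.Ur` (vendored there with that citation).

RELATION TO EXISTING TREE MODULES (internal cross-references, NOT citations).  `B5Prop11Fiber` (cell node T02.1) already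
TRANSCRIBES `∂_μ(p′+l)`, `∂¹_μ(p′)`, `v_μ`, `u` as `dSym n k p′ μ`, `d1Sym p′ μ`, `vSym n k p′ μ` (the removable point
`∂_μ = 0` filled by the printed value `1`), `uSym n k p′ = Π_μ vSym`, and proves `‖vSym‖² = uFactorr`, `‖uSym‖² = Ur` on the
zone; `B5Block118` types `Q_k`, `Q′_k` on FINITE TORI (`QvOp`, `QsOp`) and kernel-checks (1.61) there (`dft_QvOp`, from the
geometric sums `avg_om`, `sum_chi_iota`).  THIS module is the `ℤ⁴` counterpart for the an3 objects: the weights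
`AxialBlockWeights.axialWeight n μ` — whose position-space (W1)-type legs are delivered in `AxialBlockWeights` /
`BlockLegs`, whose averaging operation is `AxialComposition.axialAvg` (`axialAvg_eq_weights`) with k-fold composition
`iterate_axialAvg` — have the Fourier multiplier `weightFT n μ`, and THAT multiplier is the same printed `u·v_μ`.  New
relative to those modules: the weights ↔ symbol link on the infinite lattice, the agreement with the filled quotients for
EVERY `p′` (no zone hypothesis), the symbol-side composition law (twin of `axialAvg_comp`), and `aSym` through the weights.

WHAT IS KERNEL-CHECKED ([folklore] trigonometric sums; `n = L^k = η⁻¹`, phases `t = ηp` per INTEGER fine-lattice step):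
* `geomAvg n t = n⁻¹ Σ_{0≤j<n} e^{ijt}`, the division-free geometric identity `(e^{it} − 1)·(n·geomAvg n t) = e^{int} − 1`
  (`geom_identity`), and **`geomAvg n (η(p′_μ + 2πk_μ)) = B5Prop11Fiber.vSym n k p′ μ` for EVERY `p′`, `k`**
  (`geomAvg_eq_vSym`; at the removable point both sides are `1`) — the printed one-variable factor `∂¹_μ(p′)/∂_μ(p′+l)`;
* `weightFT n μ t = Σ_{m ∈ axialSupport n μ} axialWeight n μ m · e^{it·m}` — the Fourier multiplier of the an3 weights —
  FACTORISES: **`weightFT n μ t = (Π_ν geomAvg n (t ν)) · geomAvg n (t μ)`** (`weightFT_eq`; the block sum factorises over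
  the four coordinates, the contour sum is one more geometric average in direction `μ`); consequently, for every `n ≥ 1`,
  every `p′ : Fin 4 → ℝ` and every alias index `k : Fin 4 → Fin n`,
  **`weightFT n μ (η(p′ + 2πk)) = uSym n k p′ · vSym n k p′ μ`** (`weightFT_eq_uSym_mul_vSym`) — (1.31)·(1.61)'s
  multiplier `u_k(p)v_μ(p)`, `p = p′ + l`, attached to the `ℤ⁴` weights;
* ON THE ZONE `|p′_ν| ≤ π`: **`‖weightFT n μ (η(p′ + 2πk))‖² = B4Strip.Ur n k p′ · B4Strip.uFactorr n (k μ) (p′ μ)`**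
  (`normSq_weightFT`, via `B5Prop11Fiber.norm_uSym_sq` / `norm_vSym_sq`), so **`SymbolExpansion.aSym n μ p′ =
  Σ_k Δ₀(p′)·‖weightFT n μ (η(p′+2πk))‖²/Δ(p′+2πk)`** (`aSym_eq_weightFT`): the numerator of (1.62)'s `φ_μ` as vendored in
  the tree (`Ur · uFactorr`, cited there to B4 (2.45)) is the squared Fourier multiplier of the SAME averaging weights whose
  position-space legs `AxialBlockWeights.stepBal_le_of_axialFreeBlockSharpLk` delivers;
* printed remarks (§4): p. 23 «u_k(l) = 0 for l ≠ 0, u_k(0) = 1» for the full multiplier `u·v_μ` of the `ℤ⁴` weights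
  (`weightFT_alias_zero`, `weightFT_zero_mode`); and the SYMBOL-SIDE COMPOSITION LAW `G_{nn′}(t) = G_{n′}(nt)·G_n(t)`,
  **`weightFT (n·n′) μ t = weightFT n′ μ (n·t) · weightFT n μ t`** (`weightFT_mul_scale`) — the twin of
  `AxialComposition.axialAvg_comp` ((1.16)–(1.18): the multiplier of `Q_k` is the product of the one-step multipliers at
  the successive scales).

READING (NOT ASSERTED; the dictionary's business, BETA-SPEC §6.12 OWNERS (iii)/(v), GAPS G-beta-an3-6 (G6-a)): with the
convention (1.29), for `Q_k` of (1.18) on `ℤ⁴` (`= axialAvg (L^k) μ`), `(Q_kA)~_μ(p′) = Σ_l ŵ(η(p′+l)) Ã_μ(p′+l)` with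
`ŵ = weightFT (L^k) μ` — the Fourier bookkeeping step that `B5Block118.dft_QvOp` performs on finite tori for `QvOp`; the
identification of the `ℤ⁴` operation `axialAvg` with `QvOp` (periodisation) is NOT modelled here.  Granted it,
`weightFT_eq_uSym_mul_vSym` is (1.61) with (1.31) symbol for symbol and `normSq_weightFT` identifies (1.62)'s numerator.
This removes, AT THE SYMBOL LEVEL, the «IF u is the block-average multiplier» proviso of the `AxialBlockWeights` header /
`AxialComposition` READING; the position ↔ momentum identification of `AxialComposition.covAvg` with `Φ = Q_kΔ⁻¹Q_k*`
(Poisson summation, the normalisation of `Δ⁻¹` vs `latticeGreen`, the gauge of §C of B5) and the (R7) identification of the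
β̄-window's `C_k` remain the dictionary's checks and are NOT claimed.

WHAT THIS MODULE DOES NOT DO.  No torus, no Poisson summation, no `Δ⁻¹`, no `G(k)`, no `H_k`/`C_k`; no claim about Bałaban's
propagators or β-functions; nothing of the series (3.3)/(3.9) is discharged; no new transcription of printed objects (the
printed symbols used are `B5Prop11Fiber`'s).

CITATION HEADER (cell ABSOLUTE RULE: the manuscripts under audit are context, never authority; every identity is RE-PROVED
here as elementary algebra, not cited).
* [Balaban1984PropagatorsI] T. Bałaban, Propagators and renormalization transformations for lattice gauge theories. I,
  Comm. Math. Phys. 95 (1984) 17–40 (INDEX B5) — (1.29)–(1.31) p. 23; (1.61)–(1.62) p. 28; (1.18) p. 20 (via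
  `AxialComposition`); transcriptions via `B5Prop11Fiber`.
* [Balaban1983RegularityDecay] T. Bałaban, Regularity and decay of lattice Green's functions, Comm. Math. Phys. 89 (1983)
  571–597 (INDEX B4) — (2.45) p. 584 (the citation carried by the tree's `B4Strip.uFactorr` / `Ur`; context for the sign
  convention only).
* Internal division of labour (NOT citations): BETA-SPEC.md v1.9n §6.12 / §7.12 (R7) / §7.17 (R10); AN3.md v5.3 §13 (v1.1:
  §13.7); an3 lineage HANDOFF GEN 5; tree modules `B5Prop11Fiber`, `B5Block118` (cell node T02.1); XREAD REFEREE6.md E78.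

Tags: [folklore] = elementary algebra / trigonometric sums proved here, or a definition asserting nothing.  No `axiom`,
no `sorry`; every theorem's hypotheses are explicit binders.
-/

noncomputable section

namespace Literature.MathematicalPhysics.QuantumFieldTheory.Balaban1983to89.Beta.AxialSymbol

open Finset Complex
open Literature.MathematicalPhysics.QuantumFieldTheory.Balaban1983to89
open Literature.MathematicalPhysics.QuantumFieldTheory.Balaban1983to89.B4Strip (S1r Sxir uFactorr Ur shiftr DeltaXir
  Delta1r)
open Literature.MathematicalPhysics.QuantumFieldTheory.Balaban1983to89.B5Prop11Fiber (dSym d1Sym vSym uSym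
  dSym_eq_zero_iff norm_vSym_sq norm_uSym_sq)
open Literature.MathematicalPhysics.QuantumFieldTheory.Balaban1983to89.Beta
open Literature.MathematicalPhysics.QuantumFieldTheory.Balaban1983to89.Beta.DyadicShell
open Literature.MathematicalPhysics.QuantumFieldTheory.Balaban1983to89.Beta.BubbleTransfer
open Literature.MathematicalPhysics.QuantumFieldTheory.Balaban1983to89.Beta.AxialBlockWeights
open Literature.MathematicalPhysics.QuantumFieldTheory.Balaban1983to89.Beta.AxialComposition
open Literature.MathematicalPhysics.QuantumFieldTheory.Balaban1983to89.Beta.SymbolExpansion (aSym)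

/-! ## §1. The geometric character average; agreement with the tree's `vSym` for every `p′` -/

/-- the geometric character average `G_n(t) = n⁻¹ Σ_{0 ≤ j < n} e^{ijt}` (value `0` at `n = 0`). [folklore] -/
def geomAvg (n : ℕ) (t : ℝ) : ℂ := (∑ j ∈ Finset.range n, cexp ((j : ℂ) * ((t : ℂ) * I))) / (n : ℂ)

/-- `G_0 = 0`. [folklore] -/
theorem geomAvg_zero_scale (t : ℝ) : geomAvg 0 t = 0 := by
  simp [geomAvg]

/-- `G_n(0) = 1` for `n ≠ 0`. [folklore] -/
theorem geomAvg_at_zero (n : ℕ) (hn : n ≠ 0) : geomAvg n 0 = 1 := by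
  simp [geomAvg, hn]

/-- the division-free geometric identity `(e^{it} − 1)·(n·G_n(t)) = e^{int} − 1`. [folklore] -/
theorem geom_identity (n : ℕ) (t : ℝ) :
    (cexp ((t : ℂ) * I) - 1) * ((n : ℂ) * geomAvg n t) = cexp ((n : ℂ) * ((t : ℂ) * I)) - 1 := by
  rcases Nat.eq_zero_or_pos n with rfl | hn
  · simp [geomAvg]
  · have hn' : (n : ℂ) ≠ 0 := by exact_mod_cast hn.ne'
    unfold geomAvg
    rw [mul_div_assoc', mul_div_cancel_left₀ _ hn']
    have h : ∑ j ∈ Finset.range n, cexp ((j : ℂ) * ((t : ℂ) * I))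
        = ∑ j ∈ Finset.range n, cexp ((t : ℂ) * I) ^ j := by
      refine Finset.sum_congr rfl fun j _ => ?_
      rw [← Complex.exp_nat_mul]
    rw [h, mul_comm, geom_sum_mul, ← Complex.exp_nat_mul]

/-- if `e^{it} = 1` every term is `1`: `G_n(t) = 1` (`n ≠ 0`). [folklore] -/
theorem geomAvg_eq_one_of (n : ℕ) (hn : n ≠ 0) (t : ℝ) (h : cexp ((t : ℂ) * I) = 1) : geomAvg n t = 1 := by
  have hn' : (n : ℂ) ≠ 0 := by exact_mod_cast hn
  unfold geomAvg
  have h1 : ∀ j : ℕ, cexp ((j : ℂ) * ((t : ℂ) * I)) = 1 := fun j => by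
    rw [Complex.exp_nat_mul, h, one_pow]
  simp [h1, hn']

/-- if `e^{it} ≠ 1`: `G_n(t) = (e^{int} − 1)/(n(e^{it} − 1))` (`n ≠ 0`). [folklore] -/
theorem geomAvg_eq_of_ne (n : ℕ) (hn : n ≠ 0) (t : ℝ) (h : cexp ((t : ℂ) * I) ≠ 1) :
    geomAvg n t = (cexp ((n : ℂ) * ((t : ℂ) * I)) - 1) / ((n : ℂ) * (cexp ((t : ℂ) * I) - 1)) := by
  have hn' : (n : ℂ) ≠ 0 := by exact_mod_cast hn
  have hd : (n : ℂ) * (cexp ((t : ℂ) * I) - 1) ≠ 0 := mul_ne_zero hn' (sub_ne_zero.mpr h)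
  rw [eq_div_iff hd, ← geom_identity n t]
  ring

/-- `e^{in·η(p′_μ + 2πk_μ)} = e^{ip′_μ}` (`ηn = 1`, `e^{2πik_μ} = 1`). [folklore] -/
theorem exp_scale_shiftr (n : ℕ) [NeZero n] (k : Fin 4 → Fin n) (s : Fin 4 → ℝ) (μ : Fin 4) :
    cexp ((n : ℂ) * (((shiftr n k s μ / n : ℝ) : ℂ) * I)) = cexp (((s μ : ℝ) : ℂ) * I) := by
  rw [Complex.exp_eq_exp_iff_exists_int]
  refine ⟨((k μ : ℕ) : ℤ), ?_⟩
  have hn : (n : ℂ) ≠ 0 := by exact_mod_cast NeZero.ne n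
  unfold shiftr
  push_cast
  field_simp

/-- **For EVERY `p′` and alias index `k`: `G_n(η(p′_μ + 2πk_μ)) = v_μ(p′ + l)`** in the tree's transcription
`B5Prop11Fiber.vSym` (removable point included: there both sides are `1`). [folklore] -/
theorem geomAvg_eq_vSym (n : ℕ) [NeZero n] (k : Fin 4 → Fin n) (s : Fin 4 → ℝ) (μ : Fin 4) :
    geomAvg n (shiftr n k s μ / n) = vSym n k s μ := by
  have hn0 : n ≠ 0 := NeZero.ne n
  have hn : (n : ℂ) ≠ 0 := by exact_mod_cast hn0
  have hd : dSym n k s μ = (n : ℂ) * (cexp (((shiftr n k s μ / n : ℝ) : ℂ) * I) - 1) := rfl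
  unfold vSym
  by_cases h : cexp (((shiftr n k s μ / n : ℝ) : ℂ) * I) = 1
  · have hd0 : dSym n k s μ = 0 := by rw [hd, h, sub_self, mul_zero]
    rw [if_pos hd0, geomAvg_eq_one_of n hn0 _ h]
  · have hd0 : dSym n k s μ ≠ 0 := by rw [hd]; exact mul_ne_zero hn (sub_ne_zero.mpr h)
    rw [if_neg hd0, geomAvg_eq_of_ne n hn0 _ h, exp_scale_shiftr, hd]
    rfl

/-! ## §2. The Fourier multiplier of the axial weights -/

/-- the Fourier multiplier of the axial block-and-contour weights at the phase vector `t` (phase per integer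
fine-lattice step, `t = ηp`): `ŵ(t) = Σ_m axialWeight n μ m · e^{it·m}` (the weights of
`AxialComposition.axialAvg_eq_weights`). [folklore] -/
def weightFT (n : ℕ) (μ : Fin 4) (t : Fin 4 → ℝ) : ℂ :=
  ∑ m ∈ axialSupport n μ, (axialWeight n μ m : ℂ) * cexp ((∑ ν, (t ν : ℂ) * (m ν : ℂ)) * I)

/-- complex analogue of `AxialBlockWeights.sum_axialWeight_mul`: averaging against the weights = averaging over the
index set. [folklore] -/
theorem sum_axialWeight_mul_complex (n : ℕ) (μ : Fin 4) (G : Pt → ℂ) :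
    ∑ m ∈ axialSupport n μ, (axialWeight n μ m : ℂ) * G m = (∑ q ∈ idx n, G (pt μ q)) / (n : ℂ) ^ 5 := by
  unfold axialSupport axialWeight fiber
  rw [Finset.sum_comp G (pt μ), Finset.sum_div]
  refine Finset.sum_congr rfl fun m _ => ?_
  rw [nsmul_eq_mul]
  push_cast
  ring

/-- the phase of an index point: `t·(pt μ (x, j)) = t·x + t_μ j`. [folklore] -/
theorem phase_pt (μ : Fin 4) (t : Fin 4 → ℝ) (q : Pt × ℕ) :
    (∑ ν, (t ν : ℂ) * ((pt μ q ν : ℤ) : ℂ)) = (∑ ν, (t ν : ℂ) * (q.1 ν : ℂ)) + (t μ : ℂ) * (q.2 : ℂ) := by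
  simp only [pt_apply, Int.cast_add, Int.cast_ite, Int.cast_natCast, Int.cast_zero, mul_add, mul_ite, mul_zero,
    Finset.sum_add_distrib, Finset.sum_ite_eq', Finset.mem_univ, if_true]

/-- reindexing `Ico (0:ℤ) n` by `range n`. [folklore] -/
theorem sum_Ico_int_eq_sum_range (n : ℕ) (F : ℤ → ℂ) :
    ∑ a ∈ Finset.Ico (0 : ℤ) n, F a = ∑ j ∈ Finset.range n, F j := by
  refine Finset.sum_nbij' (fun a => a.toNat) (fun j => (j : ℤ)) ?_ ?_ ?_ ?_ ?_
  · intro a ha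
    simp only [Finset.mem_Ico] at ha
    simp only [Finset.mem_range]
    omega
  · intro j hj
    simp only [Finset.mem_range] at hj
    simp only [Finset.mem_Ico]
    omega
  · intro a ha
    simp only [Finset.mem_Ico] at ha
    omega
  · intro j _
    simp
  · intro a ha
    simp only [Finset.mem_Ico] at ha
    congr 1
    omega

/-- the block character sum factorises over coordinates: `Σ_{x ∈ [0,n)⁴} e^{it·x} = Π_ν (n·G_n(t_ν))`. [folklore] -/
theorem sum_fineBlock_exp (n : ℕ) (t : Fin 4 → ℝ) :
    ∑ x ∈ fineBlock n, cexp ((∑ ν, (t ν : ℂ) * (x ν : ℂ)) * I) = ∏ ν, ((n : ℂ) * geomAvg n (t ν)) := by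
  have h1 : ∀ x : Pt, cexp ((∑ ν, (t ν : ℂ) * (x ν : ℂ)) * I) = ∏ ν, cexp (((x ν : ℤ) : ℂ) * ((t ν : ℂ) * I)) := by
    intro x
    rw [Finset.sum_mul, Complex.exp_sum]
    refine Finset.prod_congr rfl fun ν _ => ?_
    congr 1
    ring
  simp_rw [h1]
  rw [fineBlock, ← Finset.prod_univ_sum (fun _ : Fin 4 => Finset.Ico (0 : ℤ) n)
    (fun ν a => cexp ((a : ℂ) * ((t ν : ℂ) * I)))]
  refine Finset.prod_congr rfl fun ν _ => ?_
  rw [sum_Ico_int_eq_sum_range n (fun a => cexp ((a : ℂ) * ((t ν : ℂ) * I)))]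
  rcases Nat.eq_zero_or_pos n with rfl | hn
  · simp [geomAvg]
  · have hn' : (n : ℂ) ≠ 0 := by exact_mod_cast hn.ne'
    unfold geomAvg
    rw [mul_div_assoc', mul_div_cancel_left₀ _ hn']
    refine Finset.sum_congr rfl fun j _ => ?_
    push_cast
    rfl

/-- THE FACTORISATION: `ŵ(t) = (Π_ν G_n(t_ν)) · G_n(t_μ)` — the block sum factorises over the four coordinates and the
contour sum is one more geometric average in direction `μ`. [folklore] -/
theorem weightFT_eq (n : ℕ) (μ : Fin 4) (t : Fin 4 → ℝ) :
    weightFT n μ t = (∏ ν, geomAvg n (t ν)) * geomAvg n (t μ) := by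
  rcases Nat.eq_zero_or_pos n with rfl | hn
  · simp [weightFT, axialSupport, idx_zero, geomAvg]
  · have hn' : (n : ℂ) ≠ 0 := by exact_mod_cast hn.ne'
    unfold weightFT
    rw [sum_axialWeight_mul_complex n μ (fun m => cexp ((∑ ν, (t ν : ℂ) * (m ν : ℂ)) * I))]
    have h2 : ∀ q : Pt × ℕ, cexp ((∑ ν, (t ν : ℂ) * ((pt μ q ν : ℤ) : ℂ)) * I)
        = cexp ((∑ ν, (t ν : ℂ) * (q.1 ν : ℂ)) * I) * cexp ((q.2 : ℂ) * ((t μ : ℂ) * I)) := by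
      intro q
      rw [phase_pt, add_mul, Complex.exp_add]
      congr 2
      ring
    simp_rw [h2]
    rw [idx, Finset.sum_product]
    dsimp only
    rw [← Finset.sum_mul_sum, sum_fineBlock_exp, Finset.prod_mul_distrib, Finset.prod_const, Finset.card_univ,
      Fintype.card_fin]
    have hG : geomAvg n (t μ) = (∑ j ∈ Finset.range n, cexp ((j : ℂ) * ((t μ : ℂ) * I))) / n := rfl
    rw [hG]
    generalize (∑ j ∈ Finset.range n, cexp ((j : ℂ) * ((t μ : ℂ) * I))) = S
    field_simp

/-- normalisation: `ŵ(0) = 1` (`n ≠ 0`; = `AxialBlockWeights.sum_axialWeight`). [folklore] -/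
theorem weightFT_at_zero (n : ℕ) (hn : n ≠ 0) (μ : Fin 4) : weightFT n μ (fun _ => 0) = 1 := by
  simp [weightFT_eq, geomAvg_at_zero n hn]

/-- **«ŵ(ηp) = u_k(p)·v_μ(p)», (1.31)·(1.61), for EVERY `p′` and alias `l = 2πk`**, in the tree's transcription
`B5Prop11Fiber.uSym` / `vSym` (removable points included): the Fourier multiplier of the `ℤ⁴` block-and-contour weights
IS the printed multiplier. [folklore] -/
theorem weightFT_eq_uSym_mul_vSym (n : ℕ) [NeZero n] (μ : Fin 4) (s : Fin 4 → ℝ) (k : Fin 4 → Fin n) :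
    weightFT n μ (fun ν => shiftr n k s ν / n) = uSym n k s * vSym n k s μ := by
  rw [weightFT_eq]
  have h : ∀ ν, geomAvg n (shiftr n k s ν / n) = vSym n k s ν := fun ν => geomAvg_eq_vSym n k s ν
  simp_rw [h]
  rfl

/-! ## §3. On the zone: the modulus squared is the tree's `Ur · uFactorr`; `aSym` through the weights -/

/-- THE ZONE THEOREM: for `|p′_ν| ≤ π` and every alias `l = 2πk`, `k : Fin 4 → Fin n`,
`‖ŵ(η(p′ + l))‖² = Ur n k p′ · uFactorr n (k μ) (p′ μ)` = the tree's transcription of the printed `|u(p′+l)|²|v_μ(p′+l)|²`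
((1.62); [Balaban1983RegularityDecay] (2.45) for `|u|²`). [folklore] -/
theorem normSq_weightFT (n : ℕ) [NeZero n] (μ : Fin 4) (s : Fin 4 → ℝ) (hs : ∀ ν, |s ν| ≤ Real.pi)
    (k : Fin 4 → Fin n) :
    ‖weightFT n μ (fun ν => shiftr n k s ν / n)‖ ^ 2 = Ur n k s * uFactorr n (k μ : ℕ) (s μ) := by
  have hn : 1 ≤ n := NeZero.one_le
  rw [weightFT_eq_uSym_mul_vSym n μ s k, norm_mul, mul_pow, norm_uSym_sq n hn k s hs, norm_vSym_sq n hn k s μ (hs μ)]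

/-- COROLLARY: the tree's `aSym n μ p′` (`= Δ₀(p′)·φ_μ(p′)` of (1.62), transcribed in `SymbolExpansion`) is the alias sum of
squared Fourier multipliers of the axial weights: `aSym n μ p′ = Σ_k Δ₀(p′)·‖ŵ(η(p′+2πk))‖²/Δ(p′+2πk)` on the zone. [folklore] -/
theorem aSym_eq_weightFT (n : ℕ) [NeZero n] (μ : Fin 4) (s : Fin 4 → ℝ) (hs : ∀ ν, |s ν| ≤ Real.pi) :
    aSym n μ s = ∑ k : Fin 4 → Fin n,
      Delta1r 0 s * ‖weightFT n μ (fun ν => shiftr n k s ν / n)‖ ^ 2 / DeltaXir n 0 (shiftr n k s) := by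
  unfold aSym
  refine Finset.sum_congr rfl fun k _ => ?_
  rw [normSq_weightFT n μ s hs k, mul_assoc]

/-! ## §4. Printed remarks for the `ℤ⁴` weights: «u_k(l) = 0 for l ≠ 0, u_k(0) = 1»; the symbol-side composition law -/

/-- «u_k(0) = 1»: the multiplier at `p = 0` is `1` (= the normalisation `Σ_m axialWeight = 1`). [folklore] -/
theorem weightFT_zero_mode (n : ℕ) (hn : n ≠ 0) (μ : Fin 4) : weightFT n μ (fun _ => (0 : ℝ) / n) = 1 := by
  simp [weightFT_eq, geomAvg_at_zero n hn]

/-- «u_k(l) = 0 for l ≠ 0» (p. 23): the multiplier of the `ℤ⁴` weights vanishes at every non-zero alias of `p′ = 0`.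
[folklore] -/
theorem weightFT_alias_zero (n : ℕ) [NeZero n] (μ : Fin 4) (k : Fin 4 → Fin n) (hk : ∃ ν, (k ν : ℕ) ≠ 0) :
    weightFT n μ (fun ν => (2 * Real.pi * (k ν : ℕ)) / n) = 0 := by
  have hs : ∀ ν : Fin 4, |(fun _ => (0 : ℝ)) ν| ≤ Real.pi := fun _ => by simpa using Real.pi_pos.le
  have h := normSq_weightFT n μ (fun _ => 0) hs k
  have hU : Ur n k (fun _ => 0) = 0 := by
    obtain ⟨ν, hν⟩ := hk
    unfold Ur
    exact Finset.prod_eq_zero (Finset.mem_univ ν) (by simp [uFactorr, hν, S1r])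
  rw [hU, zero_mul] at h
  have h' : weightFT n μ (fun ν => shiftr n k (fun _ => 0) ν / n) = 0 := by
    simpa using h
  simpa [shiftr] using h'

/-- reindexing `range (n·n′)` by `range n′ × range n` via `j = n·a + b`. [folklore] -/
theorem sum_range_mul_eq (n n' : ℕ) (hn : 1 ≤ n) (F : ℕ → ℂ) :
    ∑ j ∈ Finset.range (n * n'), F j = ∑ a ∈ Finset.range n', ∑ b ∈ Finset.range n, F (n * a + b) := by
  rw [← Finset.sum_product' (f := fun a b => F (n * a + b))]
  symm
  refine Finset.sum_nbij' (fun ab => n * ab.1 + ab.2) (fun j => (j / n, j % n)) ?_ ?_ ?_ ?_ ?_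
  · rintro ⟨a, b⟩ hab
    simp only [Finset.mem_product, Finset.mem_range] at hab
    simp only [Finset.mem_range]
    obtain ⟨ha, hb⟩ := hab
    calc n * a + b < n * a + n := by omega
      _ = n * (a + 1) := by ring
      _ ≤ n * n' := Nat.mul_le_mul_left _ ha
  · intro j hj
    simp only [Finset.mem_range] at hj
    simp only [Finset.mem_product, Finset.mem_range]
    refine ⟨?_, Nat.mod_lt _ (by omega)⟩
    rw [Nat.div_lt_iff_lt_mul (by omega)]
    rwa [mul_comm] at hj
  · rintro ⟨a, b⟩ hab
    simp only [Finset.mem_product, Finset.mem_range] at hab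
    obtain ⟨_, hb⟩ := hab
    simp only [Prod.mk.injEq]
    constructor
    · rw [Nat.mul_add_div (m := n) (by omega) a b, Nat.div_eq_of_lt hb, add_zero]
    · rw [Nat.mul_add_mod, Nat.mod_eq_of_lt hb]
  · intro j _
    simp only
    exact Nat.div_add_mod j n
  · rintro ⟨a, b⟩ _
    rfl

/-- THE SYMBOL-SIDE COMPOSITION LAW `G_{n·n′}(t) = G_{n′}(nt) · G_n(t)` (twin of `AxialComposition.axialAvg_comp`).
[folklore] -/
theorem geomAvg_mul_scale (n n' : ℕ) (t : ℝ) : geomAvg (n * n') t = geomAvg n' (n * t) * geomAvg n t := by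
  rcases Nat.eq_zero_or_pos n with rfl | hn
  · simp [geomAvg]
  rcases Nat.eq_zero_or_pos n' with rfl | hn'
  · simp [geomAvg]
  have hnc : (n : ℂ) ≠ 0 := by exact_mod_cast hn.ne'
  have hnc' : (n' : ℂ) ≠ 0 := by exact_mod_cast hn'.ne'
  unfold geomAvg
  rw [sum_range_mul_eq n n' hn, div_mul_div_comm, Finset.sum_mul_sum]
  push_cast
  rw [mul_comm (n' : ℂ) (n : ℂ)]
  congr 1
  refine Finset.sum_congr rfl fun a _ => Finset.sum_congr rfl fun b _ => ?_
  rw [← Complex.exp_add]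
  congr 1
  ring

/-- the multiplier of the composed average factorises accordingly:
`ŵ_{n·n′}(t) = ŵ_{n′}(n·t) · ŵ_n(t)` — the symbol side of (1.16)–(1.18) / `AxialComposition.axialAvg_comp`. [folklore] -/
theorem weightFT_mul_scale (n n' : ℕ) (μ : Fin 4) (t : Fin 4 → ℝ) :
    weightFT (n * n') μ t = weightFT n' μ (fun ν => n * t ν) * weightFT n μ t := by
  rw [weightFT_eq, weightFT_eq, weightFT_eq]
  simp_rw [geomAvg_mul_scale n n']
  rw [Finset.prod_mul_distrib]
  ring

end Literature.MathematicalPhysics.QuantumFieldTheory.Balaban1983to89.Beta.AxialSymbol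

end
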